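import Summits.CriticalPhenomena.PercolationContinuityZ3.Theorems.Transplant.SkelPhiConcFaceRouteLink
import Summits.CriticalPhenomena.PercolationContinuityZ3.Theorems.Transplant.SkelPhiRouteDatum
import Summits.CriticalPhenomena.PercolationContinuityZ3.Theorems.Transplant.SkelPhiRectAt
import HarnessLib

/-!
# D″ node, (F) part 8 at φ-level (DPRIME-SCOPE §2 L6′, M.9; hp-8 column): the ROUTE CLAUSE OF A DEEP CONTACT — the third conjunct
# `∃ Qt Ft, Ft ⊆ T ∧ Qt ⊆ D ∧ Disjoint Ft (D.Λ c Mz) ∧ 1 − ε'' < P_{Wt}(linkIn Qt (D.Λ c D.k) Ft)` of `Skelφ.kitClause'`'s per-contact input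
# `hcon'` at a kit centre `c` whose target is FAR (the next cube face of a cell step, out of reach of one certified rectangle): the Step-I′
# SIDE INPUT at `c` (p1-g9's `Skelφ.link_at_center`, extent `ℓ1` certified) is the FIRST HOP of a planar schedule `Sch` about `c` whose
# core `0` holds the landing half-side, run under the route law by part 7's `link_lt_of_schedChain` — schedule-generic φ-level re-cut of
# `SkelConcFaceContact.hroute_face` (hp-8 g24/g25)

builds on p205010 (kernel theorem, internal audit signed; external expert review pending) — nothing in this file uses p205010.
Lane `prim-bschramm`, seat `prim-hp-8` (gen 30; L6′ (F) owner); helper file (`--supports stmt-CriticalPhenomena-4575`).  Hypotheses through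
p3-g7's dictionary: `hlip : Lip G φ`, `hstep : Steps G φ`, `hfr : Frames G φ types`, `hC : CylSubcritical G φ types p`; the Step-I′ datum
`D` over `fatSeqOff off` with its certificate `h` at the running density `q` (accuracy `δ`).
* §1 window geometry about a centre: `coreT_subset_M_of_last (hlip) (hstep)` (far core in the target SPAN, one unit of depth slack),
  `coreT_nonempty_of_steps (hstep)`, `rhalf_subset_Win`, `rectPrismFin_subset_schedQt`;
* §2 the seed `fatSeqOff off c kz`: `fatSeqOff_subset_rectPrismFin` (inside the first rectangle's prism once `kz ≤ a i`, `ψ kz + off ≤ Rt`),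
  `disjoint_fatSeqOff_Win_of_beyond` (a window over planar points more than `kz` beyond `c` along a signed axis misses it);
* §3 **`routeClause_of_schedChain`** — the third conjunct of `hcon'` at `c` from: the certificate, a schedule `Sch` read through
  `planarWindowWin hlip c L` with core `0 ⊇` the landing half-side's footprint, regions and last core beyond the zone scale `Mz ≥ D.k` along
  the signed axis, the far core's window inside the target `T`, the route world inside the region `D`, part 7's chain inputs.
[cite: KozmaNitzan2024, §4 Lemma 10 Step IV (pp. 20–21), Lemma 11 (pp. 22–23), Lemma 12 (pp. 23–25), p. 30 (Step III)]
-/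

noncomputable section

open MeasureTheory ProbabilityTheory
open scoped ENNReal Classical

namespace Summit.CriticalPhenomena.PercolationContinuityZ3.Theorems.Transplant

namespace Skelφ

open Literature.Probability.Percolation Literature.Probability.LatticeModels SimpleGraph
open Literature.Probability.Percolation.KozmaNitzan
open Literature.Probability.Percolation.KozmaNitzan.Cells (oth oth_ne eq_oth_of_ne)
open Literature.Barriers.CriticalPhenomena (graphBall graphBall_finite mem_graphBall_self graphBall_mono)
open KNLevels ChainPlanar
open Skel (winGraph routeW excess)
open BoxProdZ2 (ConcRadiiG)

variable {V : Type} [DecidableEq V] [Countable V] {G : SimpleGraph V} [G.LocallyFinite] {φ : V → Site 2} {types : Finset V}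

/-! ## §1 Window geometry about a centre -/

omit [Countable V] in
/-- **The far core of a schedule lies in the target SPAN** (from `Lip`, `Steps`): if `B_G(c, L) ⊆ B_G(w₀, R₁')`, `R₁' + 1 ≤ rM_{a'}(v)` and
the last core's footprint lies in the cube `M v` (two units), then `coreT N ⊆ M_{a'}(v)` — the step device puts the far-core window into the
span (design event D3; generalises `innerSched_coreT_subset_M`). [cite: KozmaNitzan2024, §4 p. 26 (M_v), Lemma 11 (p. 23: the last face)] -/
theorem coreT_subset_M_of_last (hlip : Lip G φ) (hstep : Steps G φ) {P : PCells2} {c w₀ : V} {L R₁' : ℕ} {Λ : ConcRadiiG} {a' : ℕ}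
    {v : Site 2} {Sch : Schedule} (hball : graphBall G c L ⊆ graphBall G w₀ R₁') (hR : R₁' + 1 ≤ Λ.rM a' v)
    (hlast : Sch.core (Sch.N + 1) ⊆ P.M v) : (planarWindowWin hlip c L).coreT Sch Sch.N ⊆ (cellGeomSG G φ P w₀ Λ).M a' v := by
  intro u hu
  rw [PlanarWindow.coreT, planarWindowWin_W, mem_Win] at hu
  obtain ⟨hu1, hu2⟩ := hu
  have hM : φ u ∈ P.M v := hlast hu2
  change u ∈ VWin G φ w₀ (P.M v) (Λ.rM a' v)
  exact mem_VWin_of_zdAdj hstep (hball hu1) hR hM (P.exists_adj_of_mem_M _ hM)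

omit [Countable V] in
/-- **Nonempty true targets from `Steps`**: if some point of core `k + 1` lies within `ℓ¹`-distance `L` of `φ c`, the window of depth `L` about
`c` over it is nonempty. [cite: KozmaNitzan2024, §4 p. 26 ((29))] -/
theorem coreT_nonempty_of_steps (hlip : Lip G φ) (hstep : Steps G φ) {c : V} {L : ℕ} {Sch : Schedule} {k : ℕ}
    (hreach : ∃ y ∈ Sch.core (k + 1), (y 0 - φ c 0).natAbs + (y 1 - φ c 1).natAbs ≤ L) :
    ((planarWindowWin hlip c L).coreT Sch k).Nonempty := by
  obtain ⟨y, hy, hyL⟩ := hreach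
  obtain ⟨g, hg, hφ⟩ := exists_mem_graphBall_φ_eq hstep c y
  refine ⟨g, ?_⟩
  rw [PlanarWindow.coreT, planarWindowWin_W, mem_Win]
  exact ⟨graphBall_mono G c hyL hg, by rw [hφ]; exact hy⟩

omit [DecidableEq V] [Countable V] in
/-- **The landing half-side lies in a window** over any planar set holding its footprint (`Rt ≤ L`). [folklore] -/
theorem rhalf_subset_Win {c : V} {a : Fin 2 → ℕ} {Rt L : ℕ} {ax : Fin 2} {σ τ : ℤ} {Pl : Finset (Site 2)} (hRt : Rt ≤ L)
    (hPl : ∀ y : Site 2, y ax - φ c ax = σ * a ax → |y (oth ax) - φ c (oth ax)| ≤ a (oth ax) → y ∈ Pl) :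
    rhalf G φ c a Rt ax σ τ ⊆ Win G φ c Pl L := by
  intro w hw
  obtain ⟨hwQ, h1, -⟩ := (mem_rhalf G φ).1 hw
  exact (mem_Win G φ).2 ⟨graphBall_mono G c hRt (rectPrism_subset_graphBall G φ c a Rt hwQ),
    hPl (φ w) h1 (abs_sub_le_of_mem_rectPrism hwQ (oth ax))⟩

omit [DecidableEq V] [Countable V] in
/-- **The first rectangle's prism lies in the route world** when the first-hop footprint holds its planar box (`Rt ≤ L`). [folklore] -/
theorem rectPrismFin_subset_schedQt {c : V} {a : Fin 2 → ℕ} {Rt L : ℕ} {F : Finset (Site 2)} {Sch : Schedule} (hRt : Rt ≤ L)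
    (hF : ∀ y : Site 2, (∀ i, |y i - φ c i| ≤ a i) → y ∈ F) : rectPrismFin G φ c a Rt ⊆ schedQt G φ c L F Sch := by
  intro w hw
  have hwQ := (mem_rectPrismFin G φ).1 hw
  exact mem_schedQt_of_φ_mem (graphBall_mono G c hRt (rectPrism_subset_graphBall G φ c a Rt hwQ))
    (hF (φ w) fun i => abs_sub_le_of_mem_rectPrism hwQ i)

/-! ## §2 The seed inside the first rectangle, below the regions -/

section Seed

variable (hfr : Frames G φ types) {p : unitInterval} (hC : CylSubcritical G φ types p) (off : ℕ)

omit [DecidableEq V] in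
/-- **The seed `fatSeqOff off c kz` lies in the first rectangle's prism** once `kz ≤ a i` and `ψ kz + off ≤ Rt`. [folklore] -/
theorem fatSeqOff_subset_rectPrismFin {c : V} {kz : ℕ} {a : Fin 2 → ℕ} {Rt : ℕ} (hka : ∀ i, kz ≤ a i)
    (hR : fatRadius hfr hC kz + off ≤ Rt) : fatSeqOff hfr hC off c kz ⊆ rectPrismFin G φ c a Rt := by
  intro z hz
  have hz' := (mem_fatSeqOff_iff hfr hC off).1 hz
  refine (mem_rectPrismFin G φ).2 ⟨cylBall_mono G φ c ((hka 0).trans (le_amax a 0)) hR hz', ?_⟩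
  have hzc := cylBall_subset_cyl G φ c kz _ hz'
  rw [mem_cyl, mem_box] at hzc
  rw [mem_rcyl, mem_abox]
  intro i
  have h1 := hzc i
  have h2 : (kz : ℤ) ≤ a i := by exact_mod_cast hka i
  constructor <;> linarith [h1.1, h1.2]

omit [DecidableEq V] in
/-- **A window over planar points more than `kz` beyond `c` along the signed axis `(ax, σ)` misses the seed `fatSeqOff off c kz`** (whose
footprints lie in the cylinder `φ c + Λ_{kz}`). [cite: KozmaNitzan2024, §4 Lemma 11 (p. 22: the first cube below Ω)] -/
theorem disjoint_fatSeqOff_Win_of_beyond {c c' : V} {kz L : ℕ} {ax : Fin 2} {σ : ℤ} (hσ : σ = 1 ∨ σ = -1) {Pl : Finset (Site 2)}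
    (hPl : ∀ y ∈ Pl, (kz : ℤ) < σ * (y ax - φ c ax)) : Disjoint (fatSeqOff hfr hC off c kz) (Win G φ c' Pl L) := by
  refine Finset.disjoint_left.2 fun z hz hzW => ?_
  have hzc := fatSeqOff_subset_cyl hfr hC off c kz (Finset.mem_coe.2 hz)
  rw [mem_cyl, mem_box] at hzc
  have h1 := hzc ax
  simp only [Pi.sub_apply] at h1
  have h2 := hPl _ ((mem_Win G φ).1 hzW).2
  rcases hσ with h0 | h0 <;> rw [h0] at h2 <;> linarith [h1.1, h1.2]

end Seed

/-! ## §3 The route clause of a deep contact -/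

/-- **THE ROUTE CLAUSE OF A DEEP CONTACT** (third conjunct of `Skelφ.kitClause'`'s `hcon'` at the kit centre `c`): under the Step-I′ certificate
(accuracy `δ`), with the first-hop extent `ℓ1` certified along the axis `ax` (half-widths `a₁ := widths Gb Fb ax ℓ1`, radius
`Rt := D.R (amax a₁)`; the seed `D.Λ c D.k` inside its prism), a planar schedule `Sch` read through the window of depth `L ≥ Rt` about `c`
whose core `0` holds the `(ax, σ)`-side of the first rectangle, whose regions and last core lie strictly beyond the zone scale `Mz ≥ D.k`
along `(ax, σ)` (so the seed and the zone box are below the chain), whose route world `schedQt` lies in the region `D` of a subbox weighting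
`Wt` of `winGraph G w₀ R` (planar holder `Pl ⊇ F, regions` of diameter `m`, `B_G(c, L) ⊆ B_G(w₀, R)`, `Win w₀ Pl R ⊆ D ⊆ B_G(w₀, R)`), whose
far-core window lies in the target `T`, and part 7's chain inputs (`hchain`, abstract kits, count, rooms, a centre-uniform excess radius):
`∃ Qt Ft, Ft ⊆ T ∧ Qt ⊆ D ∧ Disjoint Ft (D.Λ c Mz) ∧ 1 − ε'' < P_{Wt}(linkIn Qt (D.Λ c D.k) Ft)`.
[cite: KozmaNitzan2024, §4 Lemma 10 Step IV (pp. 20–21), Lemma 11 (pp. 22–23), Lemma 12 (pp. 23–25)] -/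
theorem routeClause_of_schedChain (hlip : Lip G φ) (hstep : Steps G φ) (hfr : Frames G φ types) {p : unitInterval}
    (hC : CylSubcritical G φ types p) {D : StepI.Data V} {off : ℕ} (hD : D.Λ = fatSeqOff hfr hC off) {Sz Sx Sy : Finset ℕ}
    {q : unitInterval} {δ : ℝ} (h : ∀ i ∈ StepI.index types Sz Sx Sy, 1 - δ < (bondPercolation G q).real (StepI.event G φ D i))
    -- the first hop: centre, axis, sign, certified extent, its rectangle
    (c : V) (ax : Fin 2) {σ : ℤ} (hσ : σ = 1 ∨ σ = -1) {ℓ1 : ℕ} (hℓ0 : ax = 0 → ℓ1 ∈ Sx) (hℓ1 : ax = 1 → ℓ1 ∈ Sy)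
    {a₁ : Fin 2 → ℕ} (ha₁ : a₁ = StepI.widths D.Gb D.Fb ax ℓ1) {Rt : ℕ} (hRt : Rt = D.R (amax a₁))
    (hka : ∀ i, D.k ≤ a₁ i) (hkR : fatRadius hfr hC D.k + off ≤ Rt) {Mz : ℕ} (hkMz : D.k ≤ Mz)
    -- the schedule about `c`
    {L : ℕ} (hRtL : Rt ≤ L) (Sch : Schedule)
    (hcore0 : ∀ y : Site 2, y ax - φ c ax = σ * a₁ ax → |y (oth ax) - φ c (oth ax)| ≤ a₁ (oth ax) → y ∈ Sch.core 0)
    (hreg : ∀ k ≤ Sch.N, ∀ y ∈ Sch.region k, (Mz : ℤ) < σ * (y ax - φ c ax))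
    (hlastMz : ∀ y ∈ Sch.core (Sch.N + 1), (Mz : ℤ) < σ * (y ax - φ c ax))
    (hreach : ∀ k ≤ Sch.N, ∃ y ∈ Sch.core (k + 1), (y 0 - φ c 0).natAbs + (y 1 - φ c 1).natAbs ≤ L)
    -- the route world inside the region of the outer law; the far core inside the target
    {F Pl : Finset (Site 2)} {m : ℕ} (hFbox : ∀ y : Site 2, (∀ i, |y i - φ c i| ≤ a₁ i) → y ∈ F) (hF : F ⊆ Pl)
    (hPlS : ∀ k ≤ Sch.N, Sch.region k ⊆ Pl) (hPl : ∀ y ∈ Pl, ∀ y' ∈ Pl, y - y' ∈ box 2 m)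
    {w₀ : V} {R : ℕ} {Wt : Sym2 V → unitInterval} {Dr T : Finset V} (hWG : ∀ e, e ∉ G.edgeSet → Wt e = 0)
    (hWD : IsSubbox (winGraph G w₀ R) Wt q Dr) (hDR : ∀ u ∈ Dr, u ∈ graphBall G w₀ R) (hball : graphBall G c L ⊆ graphBall G w₀ R)
    (hPlD : Win G φ w₀ Pl R ⊆ Dr) (hT : (planarWindowWin hlip c L).coreT Sch Sch.N ⊆ T)
    -- the chain inputs of part 7
    {η : ℝ} {R₁ L' : ℕ}
    (hR₁ : ∀ (c' : V) (R'' : ℕ), R₁ ≤ R'' → ∀ (Rw : ℕ) (D' A' : Finset V), (∀ d ∈ D', d ∈ graphBall G c' Rw) →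
      (∀ d ∈ D', ∀ d' ∈ D', φ d - φ d' ∈ box 2 m) → A' ⊆ D' → (∀ a ∈ A', a ∈ graphBall G c' (fatRadius hfr hC D.k + off)) →
        (bondPercolation G q).real (excess G c' R'' D' A') ≤ η)
    (hR : R₁ ≤ L - L') {Rlev N j₀ j₁ : ℕ} (hRl : Rlev + 1 ≤ Sch.R') (hj : j₁ ≤ Rlev) {Δ' : ℕ} {ε'' : ℝ} (hη : η ≤ δ / 2)
    (hcount : 1 / (1 - (q : ℝ)) ^ (Δ' * N) ≤ δ * ((Finset.Icc j₀ j₁).card : ℝ))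
    (hchain : ∀ (Wg : Sym2 V → unitInterval) (s : Fin (Sch.N + 1) → TStep (winGraph G c L))
      (T' : Fin (Sch.N + 1) → Finset V) (η : ℝ),
      (∀ i, (s i).L.o = (s 0).L.o) →
      (∀ i : Fin Sch.N, T' (Fin.castSucc i) ⊆ (s i.succ).L.X 0) →
      (∀ i, T' i ⊆ (s i).T) →
      (∀ i, (s i).KitsAt Wg q Δ' δ) →
      η ≤ δ / 2 →
      (∀ i, (prodBernoulli Wg).real (⋃ t ∈ (s i).T \ T' i, openConn (s 0).L.o t) ≤ η) →
      1 - δ < (prodBernoulli Wg).real (s 0).L.reachB →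
        1 - ε'' < (prodBernoulli Wg).real (⋃ t ∈ T' (Fin.last Sch.N), openConn (s 0).L.o t))
    (hKits : ∀ k ≤ Sch.N, ((schedChain G φ c L L' F Sch c Rlev N j₀ j₁).stepA (planarWindowWin hlip c L) Sch k).KitsAt
      (routeW G Wt (schedQt G φ c L F Sch) (D.Λ c D.k)) q Δ' δ) :
    ∃ Qt Ft : Finset V, Ft ⊆ T ∧ Qt ⊆ Dr ∧ Disjoint Ft (D.Λ c Mz) ∧
      1 - ε'' < (prodBernoulli Wt).real (linkIn (↑Qt : Set V) (D.Λ c D.k) Ft) := by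
  -- the route world lies in the outer region
  have hQ : schedQt G φ c L F Sch ⊆ Dr := (schedQt_subset_Win hball hF hPlS).trans hPlD
  -- the seed: inside the first rectangle, internally connected, near `c`, below every region window
  have hSU : D.Λ c D.k ⊆ rectPrismFin G φ c a₁ Rt := by
    rw [hD]; exact fatSeqOff_subset_rectPrismFin hfr hC off hka hkR
  have hUQ : rectPrismFin G φ c a₁ Rt ⊆ schedQt G φ c L F Sch := rectPrismFin_subset_schedQt hRtL hFbox
  have hconn : ∀ s ∈ D.Λ c D.k, PathIn G (↑(D.Λ c D.k) : Set V) c s := by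
    rw [hD]; exact pathIn_fatSeqOff hfr hC off c D.k
  have hc : c ∈ D.Λ c D.k := by
    rw [hD, mem_fatSeqOff_iff]; exact self_mem_cylBall G φ c _ _
  have hnear : ∀ s ∈ D.Λ c D.k, s ∈ graphBall G c (fatRadius hfr hC D.k + off) := fun s hs =>
    ((fatSeqOff_kit_room hfr hC off le_rfl).2 c s (by rw [← hD]; exact hs)).1
  have hSD : ∀ k ≤ Sch.N, Disjoint (D.Λ c D.k) ((planarWindowWin hlip c L).stepD Sch k) := fun k hk => by
    rw [PlanarWindow.stepD, planarWindowWin_W, hD]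
    exact disjoint_fatSeqOff_Win_of_beyond hfr hC off hσ fun y hy => lt_of_le_of_lt (by exact_mod_cast hkMz) (hreg k hk y hy)
  -- the first hop: the Step-I′ side input at `c`
  obtain ⟨σu, hσu⟩ : ∃ u : ℤˣ, (u : ℤ) = σ := by
    rcases hσ with h0 | h0
    · exact ⟨1, by rw [h0, Units.val_one]⟩
    · exact ⟨-1, by rw [h0, Units.val_neg, Units.val_one]⟩
  have hev := link_at_center hfr hC hD h c ax hℓ0 hℓ1 σu 1
  rw [← ha₁, ← hRt, hσu, Units.val_one, ← coe_rectPrismFin] at hev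
  have hT₀ : rhalf G φ c a₁ Rt ax σ 1 ⊆ Win G φ c (Sch.core 0) L := rhalf_subset_Win hRtL hcore0
  -- the chain, transferred
  have key := link_lt_of_schedChain hlip hWG hWD hDR hQ hF hPlS hPl (hSU.trans hUQ) hc hconn hnear hSD hR₁ hR hRl hj hη hcount
    hchain (fun k hk => coreT_nonempty_of_steps hlip hstep (hreach k hk)) hKits hUQ (hUQ.trans hQ) subset_rfl hSU hT₀ hev
  refine ⟨schedQt G φ c L F Sch, (planarWindowWin hlip c L).coreT Sch Sch.N, hT, hQ, ?_, key⟩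
  -- the far core is beyond the zone box
  rw [PlanarWindow.coreT, planarWindowWin_W, hD]
  exact (disjoint_fatSeqOff_Win_of_beyond hfr hC off hσ hlastMz).symm

end Skelφ

end Summit.CriticalPhenomena.PercolationContinuityZ3.Theorems.Transplant

end
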